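import Mathlib.Analysis.SpecificLimits.Basic
import Mathlib.Analysis.SpecialFunctions.Log.Basic
import HarnessLib

/-!
# QUANT lane (R6/O1): summable tolerances give no rate — why every tolerance must be scale-free

builds on p205010 (kernel theorem, internal audit signed; external expert review pending)

Cell `prim-quant` (post-continuity programme, LANE 1), seat `prim-quant-p2` (METHOD = effective Kozma–Nitzan
reduction), memo `run/shared/lean/prim/quant/P2-EFFECTIVE-KN.md` §7.2.

The lane's rates come from the disjoint-annuli product: a crossing defect `η_i` at each scale `n_i` of a scale
sequence gives `π_{p_c}(N) ≤ ∏_{i < I(N)} (1 - η_i)` (`Quant.oneArmRate_of_scaleDefect`, constant `η`).  A repair of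
Kozma–Nitzan's Lemma 10 that makes the scale map polynomial (`log n_{i+1} ≤ C · log n_i`, so `I(N) ≍ log log N`)
pays off as `(log N)^{-c}` ONLY IF the defect `η` stays a constant: this file records the elementary reason.

* `Quant.exp_neg_two_mul_sum_le_prod_one_sub` — `exp(−2 Σ η_i) ≤ ∏ (1 − η_i)` for `0 ≤ η_i ≤ 1/2`;
* `Quant.exp_le_prod_one_sub_of_geometric` — if `η_i ≤ a r^i` (`0 ≤ r < 1`) then every partial product is
  `≥ exp(−2a/(1−r)) > 0`: a summable defect sequence gives NO decay;
* `Quant.exp_le_prod_one_sub_of_inv_log` — along a polynomial-aspect scale sequence (`C · log n_i ≤ log n_{i+1}`,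
  `C > 1`) a defect `η_i ≤ b / log n_i` is geometric, so the product stays `≥ exp(−2b / (log n_0 (1 − C⁻¹)))`.

Consequence used in memo §7: in any polynomial-aspect scheme, a tolerance that shrinks even logarithmically in the
scale (e.g. an additive loss `δ · #steps` with `#steps ≍ log(scale ratio)`, or a union bound over `poly(scale)`
positions) destroys the rate; all tolerances must be `d`-constants, exactly as in the landed log*-type theorem.
A statement about real sequences and nothing more.  No definitions; no sorries; standard axioms. [folklore]
-/

noncomputable section

namespace Summit.CriticalPhenomena.PercolationContinuityZ3.Theorems.Quant

open Finset

/-- **Product lower bound.** For `0 ≤ η_i ≤ 1/2`: `exp(−2 Σ_{i ∈ s} η_i) ≤ ∏_{i ∈ s} (1 − η_i)`. [folklore] -/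
theorem exp_neg_two_mul_sum_le_prod_one_sub (s : Finset ℕ) (η : ℕ → ℝ) (h0 : ∀ i ∈ s, 0 ≤ η i)
    (h1 : ∀ i ∈ s, η i ≤ 1 / 2) : Real.exp (-2 * ∑ i ∈ s, η i) ≤ ∏ i ∈ s, (1 - η i) := by
  -- `exp(−2t) ≤ 1/(1+2t) ≤ 1 − t` for `0 ≤ t ≤ 1/2` (the tree proves the same inequality inside
  -- `exp_le_prodBernoulli_real_forall_notMem` and in `Chen.exp_neg_two_mul_le_one_sub`; kept local here)
  have key : ∀ t : ℝ, 0 ≤ t → t ≤ 1 / 2 → Real.exp (-2 * t) ≤ 1 - t := by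
    intro t ht0 ht1
    have hexp : 2 * t + 1 ≤ Real.exp (2 * t) := Real.add_one_le_exp _
    have hpos : 0 < 2 * t + 1 := by linarith
    rw [show -2 * t = -(2 * t) by ring, Real.exp_neg]
    calc (Real.exp (2 * t))⁻¹ ≤ (2 * t + 1)⁻¹ := inv_anti₀ hpos hexp
      _ ≤ 1 - t := by
          rw [inv_eq_one_div, div_le_iff₀ hpos]
          nlinarith
  rw [Finset.mul_sum, Real.exp_sum]
  exact Finset.prod_le_prod (fun i _ => (Real.exp_pos _).le) fun i hi => key _ (h0 i hi) (h1 i hi)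

/-- **Summable (geometric) defects give no decay.**  If `0 ≤ η_i ≤ 1/2` and `η_i ≤ a · r^i` with `0 ≤ a`,
`0 ≤ r < 1`, then for every `K`, `∏_{i < K} (1 − η_i) ≥ exp(−2a/(1−r))` — a positive constant independent of `K`.
[folklore] -/
theorem exp_le_prod_one_sub_of_geometric {η : ℕ → ℝ} {a r : ℝ} (ha : 0 ≤ a) (hr0 : 0 ≤ r) (hr1 : r < 1)
    (h0 : ∀ i, 0 ≤ η i) (h1 : ∀ i, η i ≤ 1 / 2) (hη : ∀ i, η i ≤ a * r ^ i) (K : ℕ) :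
    Real.exp (-2 * (a / (1 - r))) ≤ ∏ i ∈ Finset.range K, (1 - η i) := by
  have hgeom : ∑ i ∈ Finset.range K, r ^ i ≤ (1 - r)⁻¹ :=
    sum_le_hasSum (Finset.range K) (fun i _ => pow_nonneg hr0 i) (hasSum_geometric_of_lt_one hr0 hr1)
  have hsum : ∑ i ∈ Finset.range K, η i ≤ a / (1 - r) := by
    calc ∑ i ∈ Finset.range K, η i ≤ ∑ i ∈ Finset.range K, a * r ^ i := Finset.sum_le_sum fun i _ => hη i
      _ = a * ∑ i ∈ Finset.range K, r ^ i := by rw [Finset.mul_sum]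
      _ ≤ a * (1 - r)⁻¹ := mul_le_mul_of_nonneg_left hgeom ha
      _ = a / (1 - r) := by rw [div_eq_mul_inv]
  calc Real.exp (-2 * (a / (1 - r))) ≤ Real.exp (-2 * ∑ i ∈ Finset.range K, η i) :=
        Real.exp_le_exp.2 (by linarith)
    _ ≤ ∏ i ∈ Finset.range K, (1 - η i) :=
        exp_neg_two_mul_sum_le_prod_one_sub _ η (fun i _ => h0 i) (fun i _ => h1 i)

/-- Along a polynomial-aspect scale sequence the logarithms grow geometrically:
`C · log n_i ≤ log n_{i+1}` for all `i` gives `C^i · log n_0 ≤ log n_i`. [folklore] -/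
theorem pow_mul_log_le_log_of_polyAspect {n : ℕ → ℝ} {C : ℝ} (hC : 0 ≤ C)
    (hlog : ∀ i, C * Real.log (n i) ≤ Real.log (n (i + 1))) (i : ℕ) :
    C ^ i * Real.log (n 0) ≤ Real.log (n i) := by
  induction i with
  | zero => simp
  | succ i ih =>
    calc C ^ (i + 1) * Real.log (n 0) = C * (C ^ i * Real.log (n 0)) := by ring
      _ ≤ C * Real.log (n i) := mul_le_mul_of_nonneg_left ih hC
      _ ≤ Real.log (n (i + 1)) := hlog i

/-- **Logarithmically shrinking tolerances give no rate at polynomial aspect.**  Let `n_0 > 1` and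
`C · log n_i ≤ log n_{i+1}` with `C > 1` (each scale at most a fixed power of the previous one, as for a polynomial
Lemma 10), and let the per-scale defect satisfy `0 ≤ η_i ≤ 1/2`, `η_i ≤ b / log n_i` (`b ≥ 0`).  Then for every `K`,
`∏_{i < K} (1 − η_i) ≥ exp(−2 b / (log n_0 · (1 − C⁻¹))) > 0`: the disjoint-annuli product does not tend to `0`,
so such a scheme proves NO one-arm rate.  Hence every tolerance of a polynomial-aspect scheme must be scale-free
(memo §7.2; a statement about real sequences and nothing more). [folklore] -/
theorem exp_le_prod_one_sub_of_inv_log {n : ℕ → ℝ} {C b : ℝ} (hC : 1 < C) (hb : 0 ≤ b) (hn0 : 1 < n 0)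
    (hlog : ∀ i, C * Real.log (n i) ≤ Real.log (n (i + 1))) {η : ℕ → ℝ} (h0 : ∀ i, 0 ≤ η i)
    (h1 : ∀ i, η i ≤ 1 / 2) (hη : ∀ i, η i ≤ b / Real.log (n i)) (K : ℕ) :
    Real.exp (-2 * (b / Real.log (n 0) / (1 - C⁻¹))) ≤ ∏ i ∈ Finset.range K, (1 - η i) := by
  have hC0 : 0 < C := lt_trans zero_lt_one hC
  have hlog0 : 0 < Real.log (n 0) := Real.log_pos hn0
  have hr0 : 0 ≤ C⁻¹ := inv_nonneg.2 hC0.le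
  have hr1 : C⁻¹ < 1 := inv_lt_one_of_one_lt₀ hC
  refine exp_le_prod_one_sub_of_geometric (div_nonneg hb hlog0.le) hr0 hr1 h0 h1 (fun i => ?_) K
  -- `η i ≤ b / log n_i ≤ b / (C^i log n_0) = (b / log n_0) · (C⁻¹)^i`
  have hli : C ^ i * Real.log (n 0) ≤ Real.log (n i) := pow_mul_log_le_log_of_polyAspect hC0.le hlog i
  have hCi : 0 < C ^ i := pow_pos hC0 i
  have hpos : 0 < C ^ i * Real.log (n 0) := mul_pos hCi hlog0
  calc η i ≤ b / Real.log (n i) := hη i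
    _ ≤ b / (C ^ i * Real.log (n 0)) := div_le_div_of_nonneg_left hb hpos hli
    _ = b / Real.log (n 0) * C⁻¹ ^ i := by
        rw [inv_pow, ← one_div, div_mul_div_comm, mul_one, mul_comm (Real.log (n 0)) (C ^ i)]

end Summit.CriticalPhenomena.PercolationContinuityZ3.Theorems.Quant
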